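import Literature.NumberTheory.Rogawski1990.ArchTransfFamilyMirrorPairing   -- ★ p849747∕(GLUE-X-dress): `slotPerm`, `partnerPerms`, `sum_partnerPerms_comp_update`, `slotPerm_update_swap_mul`, `archERhoG_mul_archRG_slotPerm`, `prod_sign_update_swap_mul`
import Literature.NumberTheory.Rogawski1990.ArchTransfFamilyWeyl          -- ★ (LH7-p02): `slotPerm_negXAt_of_eq_one`; brings ★ `ArchTransfFamilySymmetries` (`slotPerm_add_angleShift`, `circleExp_angleShift_eq_one`) and ★ `ArchHCSpaceG` (`hcSwapAt`, the clauses)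
import HarnessLib

/-!
# `stableSumG` — the STABLE SUM of an `R′`-normalised Cartan-indexed family on the `G′`∕`G`-atlas (the alternating Weyl sum in the twisted currency), its full Weyl
# relabelling algebra, and the stable-regular set — PART 1 (Shelstad 1979 §4 pp. 22–26, Lemma 4.2; Bouaziz 1994 §6.2 p. 591; Rogawski 1990 §4.1 (4.1.1), §3.7 Prop. 3.7.1)

Topic `NumberTheory/Rogawski1990`; namespace `Literature.NumberTheory.Rogawski1990`.  Definitions WITH BODIES + theorems (no instance, no notation, no axiom, no named fact,
no `sorry`).  Cell `pub/hodgecm-mathlib`, crux H413 = `stmt-HodgeConjecture-24833`, road «N8-INNER» (row 2 `stub_N8`, archimedean INNER transfer `G′_∞ → G_∞`; LEAD F0P3a-plan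
(g15) T14-4 (L2), dealer LH2-plan (g1) DEAL #1 2026-09-02T15:34:48Z brick **(2) «STABLE-SUM-G»**, FILE 1 of 2; N8-ROAD-CENSUS v0 §2 row «STABLE families», §5 (2)); seat LH10-p02
(g9).  The `G`-side twin of ★ `ArchCartanStableSum.stableSum` (LH3-p01), written in the ★ partner-sum currency of ★ `ArchTransfFamily` (`slotPerm`, `partnerPerms`) so that the
κ-road and the inner road index stable classes the same way.

THE MATHEMATICS.  A regular element of a Cartan subgroup `T_{S′}` of `G′_w = U(2,1)` or `U(3)` (compact at `w ∉ S′`, eigen-angles `θ_0, θ_1, θ_2` in the three slots) is stably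
conjugate exactly to the elements with PERMUTED slots [Rogawski1990 §3.7 Prop. 3.7.1: three classes in the stable class of a regular elliptic element of `U(2,1)`, one otherwise];
at a split place stable conjugacy is conjugacy.  The members `F` of ★ `ArchHCSpaceG s jc′` are `R′`-normalised ORDINARY families: `F S′ = archRG S′ · Φ` with `Φ` a class function
(clause (W): `F(swap c)·R′(c) = R′(swap c)·F(c)` for the REALISED swaps), and the jump clause (I₃) differentiates the twisted family `'F := archERhoG S′ • F S′`, whose Weyl denominator
`Δ_G := archERhoG S′ · archRG S′ = ∏_{i<j} 2i sin((θ_i − θ_j)∕2)` is ALTERNATING under every slot permutation (★ `archERhoG_mul_archRG_slotPerm`).  Hence the stable sum of the class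
function, `Φ^st(c) = Σ_ρ Φ(ρ·c)` over `ρ ∈ partnerPerms S′` (all of `S₃` at each compact place), reads in the two currencies as

  `'F^st = Σ_ρ sign(ρ) · 'F(ρ·c)`  (ALTERNATING sum),   `F^st(c) = archRG(c)·Φ^st(c) = Σ_ρ u_ρ(c) · F(ρ·c)`,  `u_ρ(c) := sign(ρ) · archERhoG(ρ·c) ∕ archERhoG(c)` (a UNIT),

and this file DEFINES **`stableSumG F S′ c := Σ_{ρ ∈ partnerPerms S′} stableTwistG S′ ρ c · F S′ (slotPerm ρ c)`** with the unit twist `stableTwistG` spelled division-free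
(`archERhoG_mul_stableSumG`: `archERhoG S′ c · stableSumG F S′ c = Σ_ρ sign ρ · (archERhoG • F S′)(slotPerm ρ c)`).  The full `S₃`-sum (rather than a sum over the `3∕1∕1` coset
representatives of the realised Weyl group) is `s`-free and group-indexed, so every symmetry is a reindexing of ★ `partnerPerms`; on an (W)-member it is `|W_s(w)|` times the coset
sum place by place (`2` at a `(2,1)` place, `6` at a `(3,0)` place — ★ `partnerWeight`'s counts).

* §1 `stableTwistG` (the unit twist), `stableSumG`; apply lemmas, `norm_stableTwistG`, `stableTwistG_mul_archERhoG`, `archERhoG_mul_stableSumG` (the alternating reading), linearity.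
* §2 relabelling algebra: `slotPerm_hcSwapAt` (`ρ·(swap c) = (update ρ w (swap·ρ_w))·c`), `hcSwapAt_eq_slotPerm`, `partnerPerms_induction` (every `ρ ∈ partnerPerms S′` is reached
  from `1` by left transpositions at compact places), `stableTwistG_add_angleShift`, `stableTwistG_negXAt`, `stableTwistG_hcSwapAt_mul_archERhoG` (★ `slotPerm_negXAt_of_eq_one`,
  ★ `slotPerm_add_angleShift` are LH7-p02's).
* §3 `StInRegG S′` — Bouaziz's STABLE in-regular set `T^st_{in-reg}` on the `G`-side: ALL imaginary walls removed at the compact places, real walls kept (for a stable family every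
  imaginary wall is a jump wall — the compact∕noncompact distinction is not `S₃`-invariant); `regG_subset_stInRegG`, `stInRegG_subset_inRegG` (every `s`), `slotPerm_mem_stInRegG_iff`.
PART 2 ★-cand `ArchStableSumGWeyl` (same seat): **`ArchHcStableWeyl`** ((W^st): division-free twisted symmetry under EVERY slot transposition at every compact place + `x`-even),
`archHcStableWeyl_stableSumG` (the stable sum of ANY `x`-even family is (W^st)), `stableSumG_eq_card_mul_of_mem_regG` (image = (W^st) families up to the multiplicity
`6^{#compact}`), inheritance of (P) and (I₄).  NOT HERE (FILE 2 `ArchHCSpaceGStableSum`, after the dealer's letter on SIGSHEET v1 §3): smoothness of `stableSumG F` on `StInRegG` and derivative bounds for `F ∈ ArchHCSpaceG s jc′`;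
the stable jump relations (constants `Σ_{σ} sign σ · jc′ S′ w (σ i) (σ j)`, SIGSHEET §3 (B)).  WARNING recorded there: `stableSumG F` is NOT in `ArchHCSpaceG s jc′` for a member `F`
(compact walls become jump walls; constants double) — SIGSHEET v1 §2.
HONEST LABEL: count-neutral definition organ of the road «N8-INNER»; HC_CM is proved only modulo the 7 printed citations (2 remaining: hLiu418 = stmt-HodgeConjecture-24832, h413 =
stmt-HodgeConjecture-24833) until rung 0 closes.

## References
* [Shelstad1979] D. Shelstad, *Characters and inner forms of a quasi-split group over ℝ*, Compositio Math. 39 (1979) 11–45, §4 pp. 22–26 (`R_T`, (I)–(III), Lemma 4.2 p. 23: the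
  stable sum over `𝒟(T)`; Prop. 4.5 p. 26).
* [Bouaziz1994IntegralesOrbitales] A. Bouaziz, *Intégrales orbitales sur les groupes de Lie réductifs*, Ann. Sci. ÉNS (4) 27 (1994) 573–609, §6.2 p. 591 (`ψ^{st}`, `T^st_{in-reg}`).
* [Rogawski1990] J. D. Rogawski, *Automorphic Representations of Unitary Groups in Three Variables*, Ann. of Math. Stud. 123 (1990), §3.7 Prop. 3.7.1 pp. 29–30, §4.1 (4.1.1)
  p. 39 (`Φ^st`), §4.3 (4.3.1) p. 43, §14.2 p. 232.
-/

set_option autoImplicit false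

noncomputable section

open Complex Finset Equiv
open scoped Classical
open Literature.NumberTheory.Automorphic.ArchCartan

namespace Literature.NumberTheory.Rogawski1990

variable {W : Type*} [Fintype W] [DecidableEq W]

/-! ## §1 The unit twist and the stable sum -/

section Defs

/-- **The unit twist `u_ρ(c)`** of the relabelling `ρ` on the chart `S′`: `sign(ρ) · ∏_{w ∉ S′} e^{i(c w (ρ_w 0) − c w (ρ_w 2))} · (e^{i(c w 0 − c w 2)})⁻¹`
(`= sign ρ · archERhoG S′ (slotPerm ρ c) ∕ archERhoG S′ c`, spelled division-free in `Circle`; `sign ρ := ∏_w sign ρ_w`).  It converts the alternating sum of the twisted family into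
the `R′`-currency of ★ `ArchHCSpaceG`. [cite: Shelstad1979, §4 p. 24; Lemma 4.2 (p. 23)] [cite: Bouaziz1994IntegralesOrbitales, §6.2 p. 591] -/
def stableTwistG (S' : Finset W) (ρ : W → Perm (Fin 3)) (c : W → Fin 3 → ℝ) : ℂ :=
  (∏ w, (Equiv.Perm.sign (ρ w) : ℂ)) *
    ∏ w, if w ∈ S' then (1 : ℂ) else ((Circle.exp (c w (ρ w 0) - c w (ρ w 2)) * (Circle.exp (c w 0 - c w 2))⁻¹ : Circle) : ℂ)

/-- **`stableSumG F S′ c := Σ_{ρ ∈ partnerPerms S′} u_ρ(c) · F S′ (slotPerm ρ c)`** — the STABLE SUM of a Cartan-indexed `R′`-normalised family on the chart `S′`: the sum over ALL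
slot permutations at the compact places (identity at the split places, ★ `partnerPerms`), each term re-twisted by the unit `u_ρ` so that `archERhoG S′ · stableSumG F S′` is the
ALTERNATING Weyl sum of the twisted family `archERhoG S′ • F S′` (`archERhoG_mul_stableSumG`).  For `F = R′·Φ` with `Φ` a class function this is `R′ · Φ^st`, `Φ^st(c) = Σ_ρ Φ(ρ·c)`.
[cite: Shelstad1979, Lemma 4.2 (p. 23); §4 p. 26] [cite: Rogawski1990, §4.1 (4.1.1) p. 39; §3.7 Prop. 3.7.1 pp. 29–30] [cite: Bouaziz1994IntegralesOrbitales, §6.2 p. 591] -/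
def stableSumG (F : Finset W → (W → Fin 3 → ℝ) → ℂ) (S' : Finset W) (c : W → Fin 3 → ℝ) : ℂ :=
  ∑ ρ ∈ partnerPerms S', stableTwistG S' ρ c * F S' (slotPerm ρ c)

/-- Unfolding of `stableSumG`. [cite: Shelstad1979, Lemma 4.2 (p. 23)] -/
theorem stableSumG_apply (F : Finset W → (W → Fin 3 → ℝ) → ℂ) (S' : Finset W) (c : W → Fin 3 → ℝ) :
    stableSumG F S' c = ∑ ρ ∈ partnerPerms S', stableTwistG S' ρ c * F S' (slotPerm ρ c) := rfl

/-- The twist is a unit: `‖u_ρ(c)‖ = 1`. [cite: Shelstad1979, §4 p. 24] -/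
theorem norm_stableTwistG (S' : Finset W) (ρ : W → Perm (Fin 3)) (c : W → Fin 3 → ℝ) : ‖stableTwistG S' ρ c‖ = 1 := by
  rw [stableTwistG, norm_mul, norm_prod, norm_prod]
  have h1 : ∏ w, ‖(Equiv.Perm.sign (ρ w) : ℂ)‖ = 1 := by
    refine Finset.prod_eq_one fun w _ => ?_
    rcases Int.units_eq_one_or (Equiv.Perm.sign (ρ w)) with h | h <;> simp [h]
  have h2 : ∏ w, ‖(if w ∈ S' then (1 : ℂ) else ((Circle.exp (c w (ρ w 0) - c w (ρ w 2)) * (Circle.exp (c w 0 - c w 2))⁻¹ : Circle) : ℂ))‖ = 1 := by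
    refine Finset.prod_eq_one fun w _ => ?_
    split_ifs
    · rw [norm_one]
    · rw [Circle.norm_coe]
  rw [h1, h2, mul_one]

/-- The twist never vanishes. [cite: Shelstad1979, §4 p. 24] -/
theorem stableTwistG_ne_zero (S' : Finset W) (ρ : W → Perm (Fin 3)) (c : W → Fin 3 → ℝ) : stableTwistG S' ρ c ≠ 0 := by
  intro h
  have h1 := norm_stableTwistG S' ρ c
  rw [h, norm_zero] at h1
  exact zero_ne_one h1

/-- The twist of the identity relabelling is `1`. [cite: Shelstad1979, Lemma 4.2 (p. 23)] -/
@[simp] theorem stableTwistG_one (S' : Finset W) (c : W → Fin 3 → ℝ) : stableTwistG S' (1 : W → Perm (Fin 3)) c = 1 := by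
  rw [stableTwistG]
  have h1 : ∏ w, (Equiv.Perm.sign ((1 : W → Perm (Fin 3)) w) : ℂ) = 1 :=
    Finset.prod_eq_one fun w _ => by rw [Pi.one_apply, Equiv.Perm.sign_one, Units.val_one, Int.cast_one]
  have h2 : ∏ w, (if w ∈ S' then (1 : ℂ) else
      ((Circle.exp (c w ((1 : W → Perm (Fin 3)) w 0) - c w ((1 : W → Perm (Fin 3)) w 2)) * (Circle.exp (c w 0 - c w 2))⁻¹ : Circle) : ℂ)) = 1 := by
    refine Finset.prod_eq_one fun w _ => ?_
    split_ifs
    · rfl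
    · rw [Pi.one_apply, Equiv.Perm.one_apply, Equiv.Perm.one_apply, mul_inv_cancel, Circle.coe_one]
  rw [h1, h2, mul_one]

/-- **`u_ρ(c) · archERhoG S′ c = sign(ρ) · archERhoG S′ (slotPerm ρ c)`** — the twist converts the `R′`-currency into the twisted one (no hypothesis on `ρ`: at a split place both
twists are `1`). [cite: Shelstad1979, §4 p. 24] [cite: Bouaziz1994IntegralesOrbitales, §6.2 p. 591] -/
theorem stableTwistG_mul_archERhoG (S' : Finset W) (ρ : W → Perm (Fin 3)) (c : W → Fin 3 → ℝ) :
    stableTwistG S' ρ c * archERhoG S' c = (∏ w, (Equiv.Perm.sign (ρ w) : ℂ)) * archERhoG S' (slotPerm ρ c) := by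
  rw [stableTwistG, archERhoG, archERhoG, mul_assoc, ← Finset.prod_mul_distrib]
  congr 1
  refine Finset.prod_congr rfl fun w _ => ?_
  by_cases hw : w ∈ S'
  · rw [if_pos hw, if_pos hw, if_pos hw, one_mul]
  · rw [if_neg hw, if_neg hw, if_neg hw, slotPerm_apply, slotPerm_apply, ← Circle.coe_mul, inv_mul_cancel_right]

/-- **THE ALTERNATING READING: `archERhoG S′ c · stableSumG F S′ c = Σ_ρ sign(ρ) · (archERhoG S′ • F S′)(slotPerm ρ c)`** — in the currency of ★ `hcTwistedDeriv` the stable sum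
is the alternating Weyl sum of the twisted family. [cite: Shelstad1979, Lemma 4.2 (p. 23); §4 p. 24] [cite: Bouaziz1994IntegralesOrbitales, §6.2 p. 591] -/
theorem archERhoG_mul_stableSumG (F : Finset W → (W → Fin 3 → ℝ) → ℂ) (S' : Finset W) (c : W → Fin 3 → ℝ) :
    archERhoG S' c * stableSumG F S' c =
      ∑ ρ ∈ partnerPerms S', (∏ w, (Equiv.Perm.sign (ρ w) : ℂ)) * (archERhoG S' (slotPerm ρ c) * F S' (slotPerm ρ c)) := by
  rw [stableSumG, Finset.mul_sum]
  refine Finset.sum_congr rfl fun ρ _ => ?_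
  rw [← mul_assoc, mul_comm (archERhoG S' c), stableTwistG_mul_archERhoG, mul_assoc]

/-- `stableSumG` is additive in the family. [cite: Shelstad1979, Lemma 4.2 (p. 23)] -/
theorem stableSumG_add (F G : Finset W → (W → Fin 3 → ℝ) → ℂ) (S' : Finset W) (c : W → Fin 3 → ℝ) :
    stableSumG (F + G) S' c = stableSumG F S' c + stableSumG G S' c := by
  simp only [stableSumG, Pi.add_apply, mul_add, Finset.sum_add_distrib]

/-- `stableSumG` is homogeneous in the family. [cite: Shelstad1979, Lemma 4.2 (p. 23)] -/
theorem stableSumG_smul (a : ℂ) (F : Finset W → (W → Fin 3 → ℝ) → ℂ) (S' : Finset W) (c : W → Fin 3 → ℝ) :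
    stableSumG (a • F) S' c = a * stableSumG F S' c := by
  simp only [stableSumG, Pi.smul_apply, smul_eq_mul, Finset.mul_sum]
  refine Finset.sum_congr rfl fun ρ _ => ?_
  ring

/-- The stable sum of the zero family is zero. [cite: Shelstad1979, Lemma 4.2 (p. 23)] -/
@[simp] theorem stableSumG_zero (S' : Finset W) (c : W → Fin 3 → ℝ) : stableSumG (fun _ _ => (0 : ℂ)) S' c = 0 := by
  simp [stableSumG]

/-- `stableSumG` only reads `F S′` on the partner points of `c`: families agreeing there have the same stable sum at `c`. [cite: Shelstad1979, Lemma 4.2 (p. 23)] -/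
theorem stableSumG_congr_of_forall {F F' : Finset W → (W → Fin 3 → ℝ) → ℂ} {S' : Finset W} {c : W → Fin 3 → ℝ}
    (h : ∀ ρ ∈ partnerPerms S', F S' (slotPerm ρ c) = F' S' (slotPerm ρ c)) : stableSumG F S' c = stableSumG F' S' c :=
  Finset.sum_congr rfl fun ρ hρ => by rw [h ρ hρ]

end Defs

/-! ## §2 Relabelling algebra -/

section Relabel

omit [Fintype W] in
/-- **A slot swap at `w` followed by the relabelling `ρ` is the relabelling `update ρ w (swap i j · ρ_w)`**: `slotPerm ρ (hcSwapAt w i j c) = slotPerm (update ρ w (swap i j * ρ w)) c`.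
[cite: Shelstad1979, Lemma 4.2 (p. 23)] -/
theorem slotPerm_hcSwapAt (ρ : W → Perm (Fin 3)) (w : W) (i j : Fin 3) (c : W → Fin 3 → ℝ) :
    slotPerm ρ (hcSwapAt w i j c) = slotPerm (Function.update ρ w (Equiv.swap i j * ρ w)) c := by
  funext w' l
  by_cases h : w' = w
  · subst h
    rw [slotPerm_apply, slotPerm_apply, hcSwapAt_apply_self, Function.update_self, Equiv.Perm.mul_apply]
  · rw [slotPerm_apply, slotPerm_apply, hcSwapAt_apply_of_ne h, Function.update_of_ne h]

omit [Fintype W] in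
/-- **A slot swap IS a relabelling**: `hcSwapAt w i j c = slotPerm (update 1 w (swap i j)) c`. [cite: Shelstad1979, §4 p. 23] -/
theorem hcSwapAt_eq_slotPerm (w : W) (i j : Fin 3) (c : W → Fin 3 → ℝ) :
    hcSwapAt w i j c = slotPerm (Function.update (1 : W → Perm (Fin 3)) w (Equiv.swap i j)) c := by
  have h := slotPerm_hcSwapAt (1 : W → Perm (Fin 3)) w i j c
  rw [slotPerm_one, Pi.one_apply, mul_one] at h
  exact h

/-- The single transposition at a compact place is a partner relabelling. [cite: Shelstad1979, Lemma 4.2 (p. 23)] -/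
theorem update_one_swap_mem_partnerPerms {S' : Finset W} {w : W} (hw : w ∉ S') (i j : Fin 3) :
    Function.update (1 : W → Perm (Fin 3)) w (Equiv.swap i j) ∈ partnerPerms S' := by
  have h := (update_mul_mem_partnerPerms_iff hw (Equiv.swap i j) (1 : W → Perm (Fin 3))).2 (one_mem_partnerPerms S')
  rwa [Pi.one_apply, mul_one] at h

/-- The sign of the single transposition relabelling is `−1`. [cite: Shelstad1979, Lemma 4.2 (p. 23)] -/
theorem prod_sign_update_one_swap (w : W) {i j : Fin 3} (hij : i ≠ j) :
    (∏ w', (Equiv.Perm.sign ((Function.update (1 : W → Perm (Fin 3)) w (Equiv.swap i j)) w') : ℂ)) = -1 := by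
  have h := prod_sign_update_swap_mul (1 : W → Perm (Fin 3)) w hij
  have h1 : ∏ w', (Equiv.Perm.sign ((1 : W → Perm (Fin 3)) w') : ℂ) = 1 :=
    Finset.prod_eq_one fun w' _ => by rw [Pi.one_apply, Equiv.Perm.sign_one, Units.val_one, Int.cast_one]
  rw [Pi.one_apply, mul_one, h1] at h
  exact h

/-- **Induction over the partner relabellings**: a property holding at `1` and stable under LEFT multiplication by a transposition at a compact place (`ρ ↦ update ρ w (swap x y · ρ_w)`,
`w ∉ S′`, `x ≠ y`) holds on all of `partnerPerms S′` (each `ρ_w ∈ S₃` is a product of transpositions; finitely many places). [cite: Shelstad1979, Lemma 4.2 (p. 23)] -/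
theorem partnerPerms_induction {S' : Finset W} {P : (W → Perm (Fin 3)) → Prop} (h1 : P 1)
    (hstep : ∀ ρ ∈ partnerPerms S', ∀ w, w ∉ S' → ∀ x y : Fin 3, x ≠ y → P ρ → P (Function.update ρ w (Equiv.swap x y * ρ w))) :
    ∀ ρ ∈ partnerPerms S', P ρ := by
  -- induction on the number of places where `ρ` is not the identity
  suffices H : ∀ n : ℕ, ∀ ρ ∈ partnerPerms S', (Finset.univ.filter fun w => ρ w ≠ 1).card ≤ n → P ρ from
    fun ρ hρ => H _ ρ hρ le_rfl
  intro n
  induction n with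
  | zero =>
    intro ρ _ hcard
    have hρ1 : ρ = 1 := by
      funext w
      by_contra hw
      have hmem : w ∈ Finset.univ.filter fun w => ρ w ≠ 1 := Finset.mem_filter.2 ⟨Finset.mem_univ w, hw⟩
      have := Finset.card_pos.2 ⟨w, hmem⟩
      omega
    rw [hρ1]; exact h1
  | succ n ih =>
    intro ρ hρ hcard
    by_cases hex : ∃ w, ρ w ≠ 1
    · obtain ⟨w, hw1⟩ := hex
      have hwS : w ∉ S' := fun hwS => hw1 (eq_one_of_mem_partnerPerms hρ hwS)
      -- `ρ′ := update ρ w 1` has fewer non-identity places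
      set ρ' : W → Perm (Fin 3) := Function.update ρ w 1 with hρ'
      have hρ'mem : ρ' ∈ partnerPerms S' := by
        rw [mem_partnerPerms_iff] at hρ ⊢
        intro w' hw'
        by_cases h : w' = w
        · subst h; rw [hρ', Function.update_self]
        · rw [hρ', Function.update_of_ne h]; exact hρ w' hw'
      have hcard' : (Finset.univ.filter fun w' => ρ' w' ≠ 1).card ≤ n := by
        have hsub : (Finset.univ.filter fun w' => ρ' w' ≠ 1) ⊆ (Finset.univ.filter fun w' => ρ w' ≠ 1).erase w := by
          intro w' hw'
          rw [Finset.mem_filter] at hw'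
          have hne : w' ≠ w := by
            rintro rfl
            exact hw'.2 (by rw [hρ', Function.update_self])
          refine Finset.mem_erase.2 ⟨hne, Finset.mem_filter.2 ⟨Finset.mem_univ _, ?_⟩⟩
          have := hw'.2
          rwa [hρ', Function.update_of_ne hne] at this
        have hmem : w ∈ Finset.univ.filter fun w' => ρ w' ≠ 1 := Finset.mem_filter.2 ⟨Finset.mem_univ w, hw1⟩
        have h := Finset.card_le_card hsub
        rw [Finset.card_erase_of_mem hmem] at h
        omega
      have hP' : P ρ' := ih ρ' hρ'mem hcard'
      -- climb back from `ρ′` to `ρ = update ρ′ w (ρ w · ρ′ w)` along a transposition decomposition of `ρ w`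
      have hclimb : ∀ π : Perm (Fin 3), P (Function.update ρ' w (π * ρ' w)) := by
        intro π
        induction π using Equiv.Perm.swap_induction_on with
        | one => rw [one_mul, Function.update_eq_self]; exact hP'
        | swap_mul f x y hxy ihf =>
          have hmem : Function.update ρ' w (f * ρ' w) ∈ partnerPerms S' := (update_mul_mem_partnerPerms_iff hwS f ρ').2 hρ'mem
          have h := hstep _ hmem w hwS x y hxy ihf
          rwa [Function.update_idem, Function.update_self, ← mul_assoc] at h
      have hρeq : Function.update ρ' w (ρ w * ρ' w) = ρ := by
        rw [hρ', Function.update_self, mul_one, Function.update_idem, Function.update_eq_self]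
      have := hclimb (ρ w)
      rwa [hρeq] at this
    · push Not at hex
      have hρ1 : ρ = 1 := funext hex
      rw [hρ1]; exact h1

/-- The twist is `2π`-periodic in every coordinate (it reads the angles through `Circle.exp` only). [cite: Shelstad1979, §4 p. 22] -/
theorem stableTwistG_add_angleShift (S' : Finset W) (ρ : W → Perm (Fin 3)) (c : W → Fin 3 → ℝ) (w : W) (i : Fin 3) (k : ℤ) :
    stableTwistG S' ρ (c + angleShift w i k) = stableTwistG S' ρ c := by
  rw [stableTwistG, stableTwistG]
  congr 1
  refine Finset.prod_congr rfl fun w' _ => ?_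
  split_ifs
  · rfl
  · rw [Circle.exp_sub, Circle.exp_sub, Circle.exp_sub, Circle.exp_sub, circleExp_add_angleShift, circleExp_add_angleShift, circleExp_add_angleShift,
      circleExp_add_angleShift]

/-- The twist does not read the split coordinates: it is unchanged by `negXAt w`, `w ∈ S′`. [cite: Shelstad1979, §4 p. 24] -/
theorem stableTwistG_negXAt (S' : Finset W) (ρ : W → Perm (Fin 3)) {w : W} (hw : w ∈ S') (c : W → Fin 3 → ℝ) :
    stableTwistG S' ρ (negXAt w c) = stableTwistG S' ρ c := by
  rw [stableTwistG, stableTwistG]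
  congr 1
  refine Finset.prod_congr rfl fun w' _ => ?_
  by_cases hw' : w' ∈ S'
  · rw [if_pos hw', if_pos hw']
  · have hne : w' ≠ w := fun h => hw' (h ▸ hw)
    rw [if_neg hw', if_neg hw', negXAt_apply_of_ne hne]

/-- The twist of a transposed relabelling at the swapped point: `u_{update ρ w (swap i j·ρ_w)}(c) · archERhoG(c)` and `u_ρ(swap c) · archERhoG(swap c)` are both `± archERhoG` of the
same partner point — precisely `stableTwistG S′ ρ (hcSwapAt w i j c) * archERhoG S′ (hcSwapAt w i j c) = −(stableTwistG S′ ρ° c * archERhoG S′ c)` with `ρ° = update ρ w (swap i j · ρ_w)`,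
for `i ≠ j`. [cite: Shelstad1979, Lemma 4.2 (p. 23); §4 p. 24] -/
theorem stableTwistG_hcSwapAt_mul_archERhoG (S' : Finset W) (ρ : W → Perm (Fin 3)) (w : W) {i j : Fin 3} (hij : i ≠ j) (c : W → Fin 3 → ℝ) :
    stableTwistG S' ρ (hcSwapAt w i j c) * archERhoG S' (hcSwapAt w i j c) =
      -(stableTwistG S' (Function.update ρ w (Equiv.swap i j * ρ w)) c * archERhoG S' c) := by
  rw [stableTwistG_mul_archERhoG, stableTwistG_mul_archERhoG, slotPerm_hcSwapAt, prod_sign_update_swap_mul ρ w hij]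
  ring

end Relabel

/-! ## §3 The stable in-regular set -/

section StableRegular

omit [Fintype W] [DecidableEq W] in
/-- **`StInRegG S′` — Bouaziz's STABLE in-regular set `T^st_{in-reg}` on the `G`-side**: at every compact place `w ∉ S′` the three eigenvalues `e^{iθ_i}` are pairwise distinct
(ALL imaginary walls removed — for a stable, `S₃`-symmetric family every imaginary wall is a jump wall); the real walls `x_w = 0` at the split places are kept.  `RegG S′ ⊆ StInRegG S′
⊆ InRegG s S′` for every sign pattern `s`. [cite: Bouaziz1994IntegralesOrbitales, §6.2 p. 591] [cite: Shelstad1979, §4 p. 22] -/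
def StInRegG (S' : Finset W) : Set (W → Fin 3 → ℝ) :=
  {c | ∀ w, w ∉ S' → Function.Injective fun i : Fin 3 => Circle.exp (c w i)}

omit [Fintype W] [DecidableEq W] in
/-- Unfolding of `StInRegG`. [cite: Bouaziz1994IntegralesOrbitales, §6.2 p. 591] -/
theorem mem_stInRegG_iff (S' : Finset W) (c : W → Fin 3 → ℝ) : c ∈ StInRegG S' ↔ ∀ w, w ∉ S' → Function.Injective fun i : Fin 3 => Circle.exp (c w i) := Iff.rfl

omit [Fintype W] [DecidableEq W] in
/-- `RegG S′ ⊆ StInRegG S′`. [cite: Bouaziz1994IntegralesOrbitales, §6.2 p. 591] -/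
theorem regG_subset_stInRegG (S' : Finset W) : RegG S' ⊆ StInRegG S' := fun _ hc => hc.1

omit [Fintype W] [DecidableEq W] in
/-- `StInRegG S′ ⊆ InRegG s S′` for every sign pattern. [cite: Bouaziz1994IntegralesOrbitales, §6.2 p. 591] -/
theorem stInRegG_subset_inRegG (s : W → Fin 3 → SignType) (S' : Finset W) : StInRegG S' ⊆ InRegG s S' :=
  fun _ hc w hw _ _ hij _ h => hij (hc w hw h)

omit [Fintype W] [DecidableEq W] in
/-- `StInRegG S′` with `x ≠ 0` at the split places is `RegG S′`. [cite: Shelstad1979, §4 p. 22] -/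
theorem mem_regG_iff_mem_stInRegG_and (S' : Finset W) (c : W → Fin 3 → ℝ) : c ∈ RegG S' ↔ c ∈ StInRegG S' ∧ ∀ w, w ∈ S' → c w 0 ≠ 0 := Iff.rfl

omit [Fintype W] [DecidableEq W] in
/-- `StInRegG` is stable under the partner relabellings. [cite: Shelstad1979, Lemma 4.2 (p. 23)] -/
theorem slotPerm_mem_stInRegG_iff {S' : Finset W} {ρ : W → Perm (Fin 3)} (c : W → Fin 3 → ℝ) : slotPerm ρ c ∈ StInRegG S' ↔ c ∈ StInRegG S' := by
  simp only [mem_stInRegG_iff]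
  refine forall_congr' fun w => forall_congr' fun _ => ?_
  constructor
  · intro h i j hij
    have := @h ((ρ w).symm i) ((ρ w).symm j) (by simpa only [slotPerm_apply, Equiv.apply_symm_apply] using hij)
    exact (ρ w).symm.injective this
  · intro h i j hij
    simp only [slotPerm_apply] at hij
    exact (ρ w).injective (h hij)

omit [Fintype W] in
/-- `StInRegG` is stable under every slot swap at any place off `S′` (indeed at any place: a swap permutes the three eigenvalues). [cite: Shelstad1979, §4 p. 23] -/
theorem hcSwapAt_mem_stInRegG_iff {S' : Finset W} (w : W) (i j : Fin 3) (c : W → Fin 3 → ℝ) : hcSwapAt w i j c ∈ StInRegG S' ↔ c ∈ StInRegG S' := by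
  rw [hcSwapAt_eq_slotPerm]
  exact slotPerm_mem_stInRegG_iff c

end StableRegular

end Literature.NumberTheory.Rogawski1990

end
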